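import Literature.InformationTheory.Coding.SourcePolarizationChainRule

/-!
# Stub `stub_chainRule` of line `polarize-to-one-bit-leakage` (crux `SzkEntropy.PeaTwoMemBPP`)

The conservation law of source polarization, `Σ_{j < 2^s} H(U_j | U_{<j}, Y^t) = 2^s · H(B | Y)`
for every binary source with functional side information — the named fact
`Literature.InformationTheory.Coding.Polar.ChainRule`, discharged in
`Literature/InformationTheory/Coding/SourcePolarizationChainRule.lean` (`ChainRule_holds`,
[Arıkan 2010, §III]); this file only re-exports it under the registered stub name.
-/

namespace Summit.PneNP.PneNP.Cruxes.PeaTwoMemBPP.PolarizeToOneBitLeakage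

set_option linter.dupNamespace false -- Summit.PneNP.PneNP: summit = sub-problem (D-0017)

open Literature.InformationTheory.Coding.Polar

/-- `stub_chainRule` of line polarize-to-one-bit-leakage: the conservation law (chain rule) of
source polarization, `Σ_{j < 2^s} H(U_j | U_{<j}, Y^t) = 2^s · H(B | Y)` for every binary source
with functional side information [Arıkan 2010, §III; Cover–Thomas Thm 2.5.1]. -/
theorem stub_chainRule : ChainRule :=
  ChainRule_holds

end Summit.PneNP.PneNP.Cruxes.PeaTwoMemBPP.PolarizeToOneBitLeakage
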